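import Summits.QuantumFields.YangMills.Theorems.DirichletWindowLocalGaussianityExpMomentTangentLaw
import Summits.QuantumFields.YangMills.Theorems.DirichletWindowLocalGaussianitySecondOrder
import Summits.QuantumFields.YangMills.Theorems.DirichletWindowLocalGaussianityStubKernelLower
import HarnessLib

/-!
# Stub `stub_secondOrderLocalLaw` of line «exp-moment tangent law» (item stmt-QuantumFields-12314, `DirichletWindow.LocalGaussianity`)

Registered stub 2 (the hardest) of the skeleton `Cruxes/LocalGaussianity/Lines/expmoment_tangent.lean`:
`ExpMomentBound → SecondOrderLocalLaw` — the second-order local free-gluon law on the axis,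
`β² f_β(n e₀) → D_h · (kernel01 n)²` uniformly over torus-limit states, `D_h = D/2 > 0`.  Proof: the route-independent
core `SecondOrder.secondOrder_of_expMoment` (tangent law `EquipartitionPinsProbe.stub_tangent` + rigidity + uniform
integrability from the exponential moments + Isserlis under `curvatureGaussianField 4 D`), fed with the CLOSED item
8759 `DirichletWindow.FreeEnergyLogCoefficient_holds` and the hypothesis `ExpMomentBound`; the arbitrary `[BorelSpace G]`
structure is rewritten to `borel G` (`BorelSpace.measurable_eq`), and `axis n = Pi.single 0 n`, `kernel01`, `p01` are
unfolded.  [folklore]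
-/

set_option autoImplicit false

noncomputable section

open MeasureTheory Filter Topology
open Literature.MathematicalPhysics.QuantumFieldTheory Literature.MathematicalPhysics.QuantumLattice
open Summit.QuantumFields.YangMills.Theorems.FixedDistanceLowerPsdTransfer (axis p01 kernel01)
open Summit.QuantumFields.YangMills.Theorems.LocalGaussianityExpMomentTangentLaw

namespace Summit.QuantumFields.YangMills.Cruxes.LocalGaussianity.ExpMomentTangentLaw

/-- **STUB 2 `stub_secondOrderLocalLaw`** (registered signature): the second-order local free-gluon law on the axis
from the chessboard exponential moment. -/
theorem stub_secondOrderLocalLaw : ExpMomentBound → SecondOrderLocalLaw := by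
  intro hexp G _ _ _ _ mG hBG hG r
  have hm : mG = borel G := @BorelSpace.measurable_eq G _ mG hBG
  subst hm
  letI : MeasurableSpace G := borel G
  obtain ⟨D, hD, hlaw⟩ := SecondOrder.secondOrder_of_expMoment G hG r
    (Summit.QuantumFields.YangMills.Theses.DirichletWindow.FreeEnergyLogCoefficient_holds G hG r) (hexp G hG r)
  refine ⟨(D : ℝ) / 2, by positivity, fun n ε hε => ?_⟩
  obtain ⟨β₁, hβ₁⟩ := hlaw n ε hε
  refine ⟨β₁, fun β hβ μ hμ => ?_⟩
  have h := hβ₁ β hβ μ hμ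
  unfold kernel01 p01
  rw [axis_eq_single]
  exact h

end Summit.QuantumFields.YangMills.Cruxes.LocalGaussianity.ExpMomentTangentLaw

end
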